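import Summits.CriticalPhenomena.PercolationContinuityZ3.Theorems.SahiMasterFamilyTransportMatching

/-!
# The UNCOVERED-POINT BIJECTION: an explicit perfect removal matching for one family on a topless ground set, and the typed
# one-family removal-matching statement (the `m = 1` case of conjecture (TM))

Unit `prim-masterthm-p4` (gen 25; crux anchor stmt-CriticalPhenomena-4575, helper work; memo
`run/shared/lean/prim/prim-masterthm/prim-masterthm-p4/P4-GEN25-REPORT.md` §1).  Companion of `…TransportMatching` (gen 24: the
removal-with-transport model and the typed conjecture (TM) for PAIRS of union-closed families).

THE ONE-FAMILY MODEL.  For a family `𝒰` of subsets of `Fin (n+1)`, a permutation `σ` AVOIDS `𝒰` (`Avoids`) when every cycle (as a set,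
`CycleForm.orbit`, fixed points included) is a non-member; the POINTED avoiding permutations off `y` (`AvoidsOff`) have `y` fixed and every
other cycle a non-member.  `Φ(1_𝒰) = #pointed − #avoiding` (complement form (I5), memo of gen 22; not formalised here), so an injection
"avoiding → pointed" along removals `cut y σ = swap y (σ y) * σ` (short-cut `y` out of its cycle) is a bijective proof of the vertex
inequality (V), and a perfect one on ground sets `S ∉ 𝒰` a bijective proof of `Φ_S(1_𝒰) = 0`.

CONTENTS (all `n`, every family):
* `cut`, `cut_apply_self`, the EXPLICIT INVERSE `swap (σ p) (cut (σ p) σ p) * cut (σ p) σ = σ` (`swap_mul_cut_succ`), hence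
  `succ_cut_injective`: `σ ↦ (σ p, cut (σ p) σ)` ("delete the successor of `p`") is injective on ALL permutations, and `succ_cut_surjective`:
  every `(y, σ′)` with `σ′ y = y` is hit (by `swap y (σ′ p) * σ′`).
* orbit book-keeping for `cut (σ p) σ`: cycles avoiding the cycle of `p` are unchanged (`sameCycle_cut_iff_of_not_sameCycle`), and every other
  surviving point still shares its cycle with `p` (`sameCycle_cut_of_sameCycle`).
* **`avoidsOff_cut_succ` (uncovered-point lemma)**: if NO member of `𝒰` contains `p`, then deleting the successor of `p` maps `𝒰`-avoiding
  permutations to pointed `𝒰`-avoiding permutations — together with the two previous items a BIJECTION (`avoids_of_avoidsOff_cut_succ` is the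
  converse direction).  For a union-closed `𝒰` not containing `univ` such a `p` exists (`exists_uncovered_of_unionClosed`).
* the typed ONE-FAMILY REMOVAL MATCHING statement `RemovalMatching 𝒰` (some assignment of a removal point makes "cut" land in the pointed
  avoiding permutations and be injective on avoiding ones) and **`removalMatching_of_not_mem` : union-closed `𝒰 ∌ univ ⇒ RemovalMatching 𝒰`**.
  The TOPPED case (`univ ∈ 𝒰`) is RULE T of the memo (T1 delete a fixed maximum / T2 delete the predecessor of the maximum when all prefix
  sets of its cycle are non-members / T3 recurse on the complement of that cycle), proved on paper there and machine-checked on all 2 480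
  union-closed families on ≤ 4 points and > 4·10⁶ random configurations on 5–9 points; it is NOT formalised in this file.
HONEST FRAMING: the uncovered-point case is elementary; its role is to be the base of RULE T and to show, inside the kernel, that the
removal graph of a topless ground set has an explicit perfect matching.  (TM) for pairs, (B), `UCHullNonneg k` (k ≥ 8), Sahi's `C_k` and
the master theorem remain OPEN.  Axioms standard. [this work]
-/

noncomputable section

open scoped Classical

namespace Summit.CriticalPhenomena.PercolationContinuityZ3.Theorems

namespace RemovalInjection

open Finset Function Equiv Equiv.Perm
open Literature.Combinatorics.Sahi2008.CycleForm

variable {n : ℕ}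

/-! ### Avoiding permutations, pointed avoiding permutations, the short-cut `cut` -/

/-- `σ` AVOIDS `𝒰`: every cycle of `σ` (as a set, fixed points included) is a non-member of `𝒰`. [this work] -/
def Avoids (𝒰 : Finset (Finset (Fin (n + 1)))) (σ : Perm (Fin (n + 1))) : Prop :=
  ∀ i, orbit σ i ∉ 𝒰

/-- POINTED avoiding permutation off `y`: `y` is a fixed point and every other cycle is a non-member (the avoiding permutations of the ground
set minus `y`, without reindexing). [this work] -/
def AvoidsOff (𝒰 : Finset (Finset (Fin (n + 1)))) (y : Fin (n + 1)) (σ : Perm (Fin (n + 1))) : Prop :=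
  σ y = y ∧ ∀ i, i ≠ y → orbit σ i ∉ 𝒰

/-- Short-cut `y` out of its cycle: the predecessor of `y` is sent to `σ y` and `y` becomes a fixed point (the permutation part of
`LabelTransport.remove`). [this work] -/
def cut (y : Fin (n + 1)) (σ : Perm (Fin (n + 1))) : Perm (Fin (n + 1)) :=
  swap y (σ y) * σ

/-- After the short-cut, `y` is fixed. [this work] -/
theorem cut_apply_self (y : Fin (n + 1)) (σ : Perm (Fin (n + 1))) : cut y σ y = y := by
  simp [cut, Perm.mul_apply]

/-- Deleting the successor of `p`: afterwards `p` is sent to its old second successor. [this work] -/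
theorem cut_succ_apply_base (p : Fin (n + 1)) (σ : Perm (Fin (n + 1))) : cut (σ p) σ p = σ (σ p) := by
  simp [cut, Perm.mul_apply]

/-- A point whose image is neither `y` nor `σ y` keeps its image under the short-cut. [this work] -/
theorem cut_apply_of_ne {y i : Fin (n + 1)} {σ : Perm (Fin (n + 1))} (h1 : σ i ≠ y) (h2 : σ i ≠ σ y) :
    cut y σ i = σ i := by
  simp only [cut, Perm.mul_apply]
  exact swap_apply_of_ne_of_ne h1 h2

/-- **Explicit inverse of "delete the successor of `p`"**: re-inserting the deleted point `σ p` right after `p` recovers `σ`. [this work] -/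
theorem swap_mul_cut_succ (p : Fin (n + 1)) (σ : Perm (Fin (n + 1))) :
    swap (σ p) (cut (σ p) σ p) * cut (σ p) σ = σ := by
  rw [cut_succ_apply_base, cut, ← mul_assoc, swap_mul_self, one_mul]

/-- "Delete the successor of `p` and remember it" is injective on all permutations. [this work] -/
theorem succ_cut_injective (p : Fin (n + 1)) :
    Injective fun σ : Perm (Fin (n + 1)) => (σ p, cut (σ p) σ) := by
  intro σ₁ σ₂ h
  simp only [Prod.mk.injEq] at h
  obtain ⟨h1, h2⟩ := h
  calc σ₁ = swap (σ₁ p) (cut (σ₁ p) σ₁ p) * cut (σ₁ p) σ₁ := (swap_mul_cut_succ p σ₁).symm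
    _ = swap (σ₂ p) (cut (σ₂ p) σ₂ p) * cut (σ₂ p) σ₂ := by rw [h2, h1]
    _ = σ₂ := swap_mul_cut_succ p σ₂

/-- … and every permutation fixing `y`, pointed at `y`, is reached: insert `y` right after `p` (for `y = p` this re-creates the fixed
point `p`). [this work] -/
theorem succ_cut_surjective (p y : Fin (n + 1)) (σ' : Perm (Fin (n + 1))) (hy : σ' y = y) :
    (swap y (σ' p) * σ') p = y ∧ cut y (swap y (σ' p) * σ') = σ' := by
  have h1 : (swap y (σ' p) * σ') p = y := by simp [Perm.mul_apply]
  refine ⟨h1, ?_⟩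
  have h2 : (swap y (σ' p) * σ') y = σ' p := by simp [Perm.mul_apply, hy]
  rw [cut, h2, ← mul_assoc, swap_mul_self, one_mul]

/-! ### Orbit book-keeping under the short-cut -/

/-- On a cycle of `f` avoiding both `x` and `y`, the iterates of `swap x y * f` are those of `f`
(folklore; cf. `Literature.GroupTheory.CombinatorialGroupTheory.CyclicBlockInterchangeSurgery`). [folklore] -/
theorem swap_mul_pow_apply_of_not_sameCycle {f : Perm (Fin (n + 1))} {x y a : Fin (n + 1)} (hx : ¬ f.SameCycle a x)
    (hy : ¬ f.SameCycle a y) : ∀ j : ℕ, ((swap x y * f) ^ j) a = (f ^ j) a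
  | 0 => by simp
  | j + 1 => by
    rw [pow_succ', Perm.mul_apply, swap_mul_pow_apply_of_not_sameCycle hx hy j, pow_succ', Perm.mul_apply,
      Perm.mul_apply]
    refine swap_apply_of_ne_of_ne (fun h => hx ⟨(j + 1 : ℕ), ?_⟩) (fun h => hy ⟨(j + 1 : ℕ), ?_⟩)
    · rw [zpow_natCast, pow_succ', Perm.mul_apply, h]
    · rw [zpow_natCast, pow_succ', Perm.mul_apply, h]

/-- A cycle avoiding `x, y` is untouched by `swap x y * f`: `SameCycle` from a point of it is the same relation. [folklore] -/
theorem sameCycle_swap_mul_iff_of_not_sameCycle {f : Perm (Fin (n + 1))} {x y a b : Fin (n + 1)}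
    (hx : ¬ f.SameCycle a x) (hy : ¬ f.SameCycle a y) : (swap x y * f).SameCycle a b ↔ f.SameCycle a b := by
  constructor
  · intro hab
    obtain ⟨j, -, rfl⟩ := hab.exists_pow_eq'
    exact ⟨j, by rw [zpow_natCast, swap_mul_pow_apply_of_not_sameCycle hx hy j]⟩
  · intro hab
    obtain ⟨j, -, rfl⟩ := hab.exists_pow_eq'
    exact ⟨j, by rw [zpow_natCast, swap_mul_pow_apply_of_not_sameCycle hx hy j]⟩

/-- Cycles not through `p` are unchanged by deleting the successor of `p`. [this work] -/
theorem sameCycle_cut_iff_of_not_sameCycle {σ : Perm (Fin (n + 1))} {p a b : Fin (n + 1)} (ha : ¬ σ.SameCycle a p) :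
    (cut (σ p) σ).SameCycle a b ↔ σ.SameCycle a b := by
  have h1 : ¬ σ.SameCycle a (σ p) := fun h => ha (sameCycle_apply_right.1 h)
  have h2 : ¬ σ.SameCycle a (σ (σ p)) := fun h => h1 (sameCycle_apply_right.1 h)
  exact sameCycle_swap_mul_iff_of_not_sameCycle h1 h2

/-- Hence their underlying sets are unchanged. [this work] -/
theorem orbit_cut_of_not_sameCycle {σ : Perm (Fin (n + 1))} {p a : Fin (n + 1)} (ha : ¬ σ.SameCycle a p) :
    orbit (cut (σ p) σ) a = orbit σ a := by
  ext b
  simp only [mem_orbit]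
  exact sameCycle_cut_iff_of_not_sameCycle ha

/-- Iterates of a fixed point. [folklore] -/
theorem pow_apply_eq_self_of_apply_eq_self {σ : Perm (Fin (n + 1))} {i : Fin (n + 1)} (h : σ i = i) :
    ∀ m : ℕ, (σ ^ m) i = i
  | 0 => by simp
  | m + 1 => by rw [pow_succ, Perm.mul_apply, h, pow_apply_eq_self_of_apply_eq_self h m]

/-- Iterates of a point on a 2-cycle `p ↦ σ p ↦ p`. [folklore] -/
theorem pow_apply_mem_pair_of_two_cycle {σ : Perm (Fin (n + 1))} {p : Fin (n + 1)} (h : σ (σ p) = p) :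
    ∀ m : ℕ, (σ ^ m) p = p ∨ (σ ^ m) p = σ p
  | 0 => by simp
  | m + 1 => by
    rcases pow_apply_mem_pair_of_two_cycle h m with ih | ih
    · right; rw [pow_succ', Perm.mul_apply, ih]
    · left; rw [pow_succ', Perm.mul_apply, ih, h]

/-- A surviving point of the cycle of `p` still shares its cycle with `p` after the successor of `p` is deleted. [this work] -/
theorem sameCycle_cut_of_sameCycle {σ : Perm (Fin (n + 1))} {p i : Fin (n + 1)} (hi : σ.SameCycle p i) (hne : i ≠ σ p) :
    (cut (σ p) σ).SameCycle i p := by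
  by_cases hip : i = p
  · subst hip; exact SameCycle.refl _ _
  -- the cycle of `p` has at least the three points `p, σ p, i`
  have hσi_ne_y : σ i ≠ σ p := fun h => hip (σ.injective h)
  have hσi_ne_σy : σ i ≠ σ (σ p) := fun h => hne (σ.injective h)
  have hcut_i : cut (σ p) σ i = σ i := cut_apply_of_ne hσi_ne_y hσi_ne_σy
  have hσi_ne_i : σ i ≠ i := by
    intro h
    obtain ⟨j, -, hj⟩ := hi.symm.exists_pow_eq'
    exact hip ((pow_apply_eq_self_of_apply_eq_self h j).symm.trans hj)
  have hb_i : (swap (σ p) (σ (σ p)) * σ) i ≠ i := by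
    change cut (σ p) σ i ≠ i
    rw [hcut_i]; exact hσi_ne_i
  -- `σ (σ p) ≠ p`: otherwise the cycle of `p` is `{p, σ p}` and cannot contain `i`
  have hσy_ne_p : σ (σ p) ≠ p := by
    intro h
    obtain ⟨j, -, hj⟩ := hi.exists_pow_eq'
    rcases pow_apply_mem_pair_of_two_cycle h j with h' | h'
    · exact hip (hj.symm.trans h')
    · exact hne (hj.symm.trans h')
  have hb_p : (swap (σ p) (σ (σ p)) * σ) p ≠ p := by
    change cut (σ p) σ p ≠ p
    rw [cut_succ_apply_base]; exact hσy_ne_p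
  -- both `p` and `i` are iterates of `σ (σ p)` under `σ`
  have hyp : σ.SameCycle (σ (σ p)) p := (sameCycle_apply_left.2 (sameCycle_apply_left.2 (SameCycle.refl σ p)))
  have hyi : σ.SameCycle (σ (σ p)) i := hyp.trans hi
  obtain ⟨np, -, hnp⟩ := hyp.exists_pow_eq'
  obtain ⟨ni, -, hni⟩ := hyi.exists_pow_eq'
  obtain ⟨zp, hzp⟩ := Equiv.Perm.isCycle_swap_mul_aux₁ np hb_p hnp
  obtain ⟨zi, hzi⟩ := Equiv.Perm.isCycle_swap_mul_aux₁ ni hb_i hni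
  have h1 : (cut (σ p) σ).SameCycle (σ (σ p)) p := ⟨zp, hzp⟩
  have h2 : (cut (σ p) σ).SameCycle (σ (σ p)) i := ⟨zi, hzi⟩
  exact h2.symm.trans h1

/-! ### The uncovered-point bijection -/

/-- **Uncovered-point lemma.**  If no member of `𝒰` contains `p`, deleting the successor of `p` maps `𝒰`-avoiding permutations to pointed
`𝒰`-avoiding permutations: the cycle of `p` still contains `p` (so is still a non-member) and all other cycles are unchanged. [this work] -/
theorem avoidsOff_cut_succ {𝒰 : Finset (Finset (Fin (n + 1)))} {p : Fin (n + 1)} (hp : ∀ A ∈ 𝒰, p ∉ A)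
    {σ : Perm (Fin (n + 1))} (hσ : Avoids 𝒰 σ) : AvoidsOff 𝒰 (σ p) (cut (σ p) σ) := by
  refine ⟨cut_apply_self _ _, fun i hi => ?_⟩
  by_cases h : σ.SameCycle p i
  · intro hmem
    exact hp _ hmem (mem_orbit.2 (sameCycle_cut_of_sameCycle h hi))
  · rw [orbit_cut_of_not_sameCycle (fun h' => h h'.symm)]
    exact hσ i

/-- Converse direction: if no member of `𝒰` contains `p` and `cut (σ p) σ` is pointed-avoiding off `σ p`, then `σ` avoids `𝒰`
(cycles through `p` are non-members automatically, the others are unchanged). [this work] -/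
theorem avoids_of_avoidsOff_cut_succ {𝒰 : Finset (Finset (Fin (n + 1)))} {p : Fin (n + 1)} (hp : ∀ A ∈ 𝒰, p ∉ A)
    {σ : Perm (Fin (n + 1))} (hσ : AvoidsOff 𝒰 (σ p) (cut (σ p) σ)) : Avoids 𝒰 σ := by
  intro i hmem
  by_cases h : σ.SameCycle p i
  · exact hp _ hmem (mem_orbit.2 h.symm)
  · have hne : i ≠ σ p := by
      rintro rfl
      exact h (sameCycle_apply_right.2 (SameCycle.refl σ p))
    have := hσ.2 i hne
    rw [orbit_cut_of_not_sameCycle (fun h' => h h'.symm)] at this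
    exact this hmem

/-- The pointed avoiding permutations off `y` reached from avoiding permutations by deleting the successor of an uncovered `p` are ALL of
them: the preimage `swap y (σ′ p) * σ′` avoids `𝒰`. [this work] -/
theorem avoids_preimage_of_uncovered {𝒰 : Finset (Finset (Fin (n + 1)))} {p : Fin (n + 1)} (hp : ∀ A ∈ 𝒰, p ∉ A)
    {y : Fin (n + 1)} {σ' : Perm (Fin (n + 1))} (hσ' : AvoidsOff 𝒰 y σ') :
    Avoids 𝒰 (swap y (σ' p) * σ') ∧ (swap y (σ' p) * σ') p = y ∧ cut y (swap y (σ' p) * σ') = σ' := by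
  obtain ⟨h1, h2⟩ := succ_cut_surjective p y σ' hσ'.1
  refine ⟨?_, h1, h2⟩
  apply avoids_of_avoidsOff_cut_succ hp
  rw [h1, h2]
  exact hσ'

/-! ### Existence of an uncovered point for topless union-closed families -/

/-- A nonempty union of members of a union-closed family is a member. [folklore] -/
theorem biUnion_mem_of_unionClosed {𝒰 : Finset (Finset (Fin (n + 1)))} (hU : ∀ A ∈ 𝒰, ∀ B ∈ 𝒰, A ∪ B ∈ 𝒰)
    {ι : Type*} (s : Finset ι) (hs : s.Nonempty) (A : ι → Finset (Fin (n + 1))) (hA : ∀ x ∈ s, A x ∈ 𝒰) :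
    s.biUnion A ∈ 𝒰 := by
  induction hs using Finset.Nonempty.cons_induction with
  | singleton a => simpa using hA a (mem_singleton_self a)
  | cons a s ha hs ih =>
    rw [Finset.cons_eq_insert, Finset.biUnion_insert]
    exact hU _ (hA a (by simp)) _ (ih fun x hx => hA x (by simp [hx]))

/-- **Topless union-closed families have an uncovered point**: if `univ ∉ 𝒰` then some point lies in no member of `𝒰` (otherwise `univ`
would be the union of the members through each point). [this work] -/
theorem exists_uncovered_of_unionClosed {𝒰 : Finset (Finset (Fin (n + 1)))} (hU : ∀ A ∈ 𝒰, ∀ B ∈ 𝒰, A ∪ B ∈ 𝒰)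
    (htop : (univ : Finset (Fin (n + 1))) ∉ 𝒰) : ∃ p : Fin (n + 1), ∀ A ∈ 𝒰, p ∉ A := by
  by_contra hcon
  have hcov' : ∀ q : Fin (n + 1), ∃ A ∈ 𝒰, q ∈ A := by
    intro q
    by_contra hq
    exact hcon ⟨q, fun A hA hqA => hq ⟨A, hA, hqA⟩⟩
  choose A hA hpA using hcov'
  apply htop
  have hcov : (univ : Finset (Fin (n + 1))).biUnion A = univ := by
    ext q
    simp only [mem_biUnion, mem_univ, true_and, iff_true]
    exact ⟨q, hpA q⟩
  rw [← hcov]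
  exact biUnion_mem_of_unionClosed hU univ univ_nonempty A fun x _ => hA x

/-! ### The typed one-family removal matching and its topless case -/

/-- **ONE-FAMILY REMOVAL MATCHING** for the family `𝒰` (the `m = 1` case of conjecture (TM) of `…TransportMatching`, without labels):
some assignment `f` of a removal point makes `σ ↦ (f σ, cut (f σ) σ)` land in the pointed avoiding permutations and be injective on the
avoiding ones.  A statement-valued definition, never asserted as a fact: proved below when some point is uncovered (in particular for
union-closed `𝒰 ∌ univ`); for union-closed `𝒰 ∋ univ` it is RULE T of the memo (paper proof, machine-checked on ≤ 9 points), not yet in the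
kernel. [this work] [status: topless case proved here; topped case open in the kernel] -/
@[conjecture] def RemovalMatching (𝒰 : Finset (Finset (Fin (n + 1)))) : Prop :=
  ∃ f : Perm (Fin (n + 1)) → Fin (n + 1),
    (∀ σ, Avoids 𝒰 σ → AvoidsOff 𝒰 (f σ) (cut (f σ) σ)) ∧
    (∀ σ₁ σ₂, Avoids 𝒰 σ₁ → Avoids 𝒰 σ₂ → f σ₁ = f σ₂ → cut (f σ₁) σ₁ = cut (f σ₂) σ₂ → σ₁ = σ₂)

/-- If some point is uncovered by `𝒰`, "delete the successor of that point" is a removal matching (indeed a bijection onto the pointed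
avoiding permutations, `avoids_preimage_of_uncovered`). [this work] -/
theorem removalMatching_of_uncovered {𝒰 : Finset (Finset (Fin (n + 1)))} {p : Fin (n + 1)} (hp : ∀ A ∈ 𝒰, p ∉ A) :
    RemovalMatching 𝒰 := by
  refine ⟨fun σ => σ p, fun σ hσ => avoidsOff_cut_succ hp hσ, fun σ₁ σ₂ _ _ h1 h2 => ?_⟩
  exact succ_cut_injective p (Prod.ext h1 h2)

/-- **The topless case of the one-family removal matching**: for a union-closed `𝒰` NOT containing `univ`, deleting the successor of an
uncovered point is an explicit removal matching (rule (a) of RULE T in the memo; the topped case `univ ∈ 𝒰` is RULE T's recursion and is not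
formalised here). [this work] -/
theorem removalMatching_of_not_mem {𝒰 : Finset (Finset (Fin (n + 1)))} (hU : ∀ A ∈ 𝒰, ∀ B ∈ 𝒰, A ∪ B ∈ 𝒰)
    (htop : (univ : Finset (Fin (n + 1))) ∉ 𝒰) : RemovalMatching 𝒰 := by
  obtain ⟨p, hp⟩ := exists_uncovered_of_unionClosed hU htop
  exact removalMatching_of_uncovered hp

end RemovalInjection

end Summit.CriticalPhenomena.PercolationContinuityZ3.Theorems
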